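import Mathlib.Algebra.MvPolynomial.CommRing
import Mathlib.Algebra.Algebra.Basic
import Mathlib.LinearAlgebra.Eigenspace.Basic
import HarnessLib

/-!
# Projectors onto common eigenspaces of commuting operators as low-degree polynomials in the
# generators ([BDGIL24, Thm. 5.2]) — PROVED (`BergEtAl2024.thm_5_2`, `thm_5_2_proj`,
# `thm_5_2_linearFactors`)

[BDGIL24] = M. van den Berg, P. Dutta, F. Gesmundo, C. Ikenmeyer, V. Lysikov, *Algebraic
metacomplexity and representation theory*, arXiv:2411.03444, §5.1 (p.24–25, PDF pp.25–26):

> "We construct the required projections as projections onto a common eigenspace of several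
> commuting matrices. […] an irreducible representation is spanned by a common eigenvector of the
> generators `U₁, …, U_q` of `A` with the corresponding eigenvalues `χ(U₁), …, χ(U_q)`. […] For a
> commutative algebra [complete reducibility] means that the generators of the algebra act not just
> by commuting but by simultaneously diagonalizable linear maps."
>
> **Definition 5.1.** […] the number of isomorphism types of irreducible subrepresentations of `V`
> [is] the *diversity* of `V`.
>
> **Theorem 5.2.** Let `A` be a commutative algebra generated by `U₁, …, U_q` and `V` be a
> completely reducible representation of `A` with diversity at most `p`. For every irreducible
> representation `χ_λ` of `A` there exists a polynomial `f_λ` of degree at most `p − 1` such that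
> `f_λ(U₁, …, U_q).x = Π_λ x` (16), where `Π_λ : V → V` is the unique `A`-equivariant projection
> onto the isotypic component `V_{A,λ}`.

The printed proof takes, for every other character `μ ≠ λ` occurring in `V`, a generator `U_{i_μ}`
on which `χ_λ` and `χ_μ` differ, and sets
`P_λ := ∏_{μ ≠ λ} (U_{i_μ} − χ_μ(U_{i_μ})) / (χ_λ(U_{i_μ}) − χ_μ(U_{i_μ}))` (17): each factor is the
identity on `V_{A,λ}` and zero on `V_{A,μ}`.

## Tree rendering (no new definitions)

* the field is any field `K` (the paper: `ℂ`); `A` is any commutative `K`-algebra acting on a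
  `K`-module `V` (`[Module A V] [IsScalarTower K A V]`); the generators are a family `U : ι → A`
  (a polynomial in the `Uᵢ` is `MvPolynomial.aeval U f`, `f : MvPolynomial ι K`, "degree" =
  `totalDegree`);
* a character of `A` on a common eigenvector is recorded by its values on the generators,
  `χ : ι → K`, and "`x` spans a copy of `χ`" is `∀ i, U i • x = χ i • x`; the characters occurring
  are a `Finset Λ` (diversity `≤ p` ⇔ `Λ.card ≤ p`); complete reducibility is the hypothesis that
  `V` is spanned by such common eigenvectors (`thm_5_2_proj`);
* `Π_λ` is pinned down by its defining properties: identity on `V_{A,λ}`, range inside `V_{A,λ}`,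
  idempotent, kernel = the span of the other isotypic components, `A`-equivariant.

## Main statements

* `exists_mvPolynomial_eval_eq_one_eq_zero` — the interpolation polynomial (17): total degree
  `≤ |Λ| − 1`, value `1` at `λ ∈ Λ`, value `0` on `Λ ∖ {λ}`.
* `aeval_smul_of_forall_smul_eq` — on a common eigenvector with character `χ`, `f(U)` acts as the
  scalar `f(χ)`.
* **`thm_5_2`** — Theorem 5.2 as printed: `f_λ` of total degree `≤ Λ.card − 1` with `f_λ(U)` the
  identity on the `λ`-eigenvectors and zero on the `μ`-eigenvectors, `μ ∈ Λ ∖ {λ}` (this part needs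
  no complete reducibility).
* **`thm_5_2_proj`** — under complete reducibility, `f_λ(U)` IS the projection `Π_λ`: identity on
  `V_{A,λ}`, values in `V_{A,λ}`, idempotent, kernel = span of the other common eigenvectors,
  commuting with `A`.
* `thm_5_2_eq_zero_of_not_mem` — the case `λ ∉ Λ` (`f_λ := 0`): under complete reducibility the
  `λ`-isotypic component is zero.
* **`thm_5_2_linearFactors`** — eq. (17) for a family of endomorphisms `T : ι → Module.End K V`
  (no commutativity hypothesis is needed for the eigenvector identities): an ordered product of at
  most `Λ.card − 1` factors `c • (T i − a)`, each affine-linear in ONE generator, is the identity on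
  the common `λ`-eigenvectors and zero on the common `μ`-eigenvectors, `μ ∈ Λ ∖ {λ}`. This is the
  form §5.1 uses to bound the length of the projectors by `ℓ (p − 1)`, and
  `mem_iInf_eigenspace_iff` connects the hypothesis to the tree's `⨅ i, eigenspace (T i) (χ i)`.

Not typed here: Table 5.3 / Cor. 5.5–5.8 (the three commutative subalgebras of `U(gl_k)` and the
lengths of their generators) and Thm. 5.10 (circuit simulation of `P.Δ`), which need the `U(gl_k)`
action on metapolynomials. Honest framing: linear algebra; nothing here bears on `VP ≠ VNP`.

## References
* [BergEtAl2024] arXiv:2411.03444, Def. 5.1, Thm. 5.2, eq. (16)–(17), p.25 (PDF p.26).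
-/

noncomputable section

open MvPolynomial

namespace Literature.Barriers.ValiantsHypothesis

namespace BergEtAl2024

/-! ### The interpolation polynomial (17) -/

section Interpolation

variable {K ι : Type*} [Field K]

/-- One affine-linear factor of (17): for `μ ≠ l`, in a coordinate `i` where they differ,
`(l i − μ i)⁻¹ · (X i − μ i)` has total degree `≤ 1`, value `1` at `l` and `0` at `μ`. [folklore] -/
private theorem exists_linear_factor {l μ : ι → K} (h : μ ≠ l) :
    ∃ g : MvPolynomial ι K, g.totalDegree ≤ 1 ∧ eval l g = 1 ∧ eval μ g = 0 := by
  obtain ⟨i, hi⟩ := Function.ne_iff.1 h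
  refine ⟨C (l i - μ i)⁻¹ * (X i - C (μ i)), ?_, ?_, ?_⟩
  · refine (totalDegree_mul _ _).trans ?_
    rw [totalDegree_C, zero_add]
    refine (totalDegree_sub _ _).trans ?_
    rw [totalDegree_X, totalDegree_C]
    norm_num
  · rw [map_mul, eval_C, map_sub, eval_X, eval_C]
    exact inv_mul_cancel₀ (sub_ne_zero.2 (Ne.symm hi))
  · rw [map_mul, eval_C, map_sub, eval_X, eval_C, sub_self, mul_zero]

/-- **The interpolation polynomial of (17).** For a point `l` and a finite set `Λ` of points of
`K^ι` containing `l` there is a polynomial of total degree at most `|Λ| − 1 = |Λ ∖ {l}|` — a product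
of one affine-linear factor in a single variable per point of `Λ ∖ {l}` — with value `1` at `l` and
`0` on `Λ ∖ {l}`.
[cite: BergEtAl2024, Thm. 5.2, eq. (17), p.25 (PDF p.26)] locator: paper:arxiv-2411.03444 p0026.txt:L22–L32 -/
theorem exists_mvPolynomial_eval_eq_one_eq_zero (Λ : Finset (ι → K)) {l : ι → K} (hl : l ∈ Λ) :
    ∃ f : MvPolynomial ι K, f.totalDegree ≤ Λ.card - 1 ∧ eval l f = 1 ∧
      ∀ μ ∈ Λ, μ ≠ l → eval μ f = 0 := by
  classical
  -- choose the factors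
  have hfac : ∀ μ : (ι → K), ∃ g : MvPolynomial ι K,
      g.totalDegree ≤ 1 ∧ eval l g = 1 ∧ (μ ≠ l → eval μ g = 0) := by
    intro μ
    by_cases h : μ = l
    · exact ⟨1, by simp, by simp, fun h' => absurd h h'⟩
    · obtain ⟨g, h1, h2, h3⟩ := exists_linear_factor h
      exact ⟨g, h1, h2, fun _ => h3⟩
  choose g hg1 hg2 hg3 using hfac
  refine ⟨∏ μ ∈ Λ.erase l, g μ, ?_, ?_, ?_⟩
  · refine (totalDegree_finsetProd _ _).trans ?_
    rw [← Finset.card_erase_of_mem hl]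
    calc ∑ μ ∈ Λ.erase l, (g μ).totalDegree ≤ ∑ _μ ∈ Λ.erase l, 1 :=
          Finset.sum_le_sum fun μ _ => hg1 μ
      _ = (Λ.erase l).card := by simp
  · rw [map_prod]
    exact Finset.prod_eq_one fun μ _ => hg2 μ
  · intro μ hμ hne
    rw [map_prod]
    exact Finset.prod_eq_zero (Finset.mem_erase.2 ⟨hne, hμ⟩) (hg3 μ hne)

end Interpolation

/-! ### A commutative algebra acting with common eigenvectors -/

section Algebra

variable {K A V ι : Type*} [Field K] [CommRing A] [Algebra K A] [AddCommGroup V] [Module K V]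
  [Module A V] [IsScalarTower K A V]

/-- **On a common eigenvector a polynomial in the generators acts by its value at the character**:
if `Uᵢ • x = χᵢ • x` for all `i`, then `f(U) • x = f(χ) • x`.
[cite: BergEtAl2024, §5.1, p.24 (PDF p.25)] locator: paper:arxiv-2411.03444 p0025.txt:L41–L46 -/
theorem aeval_smul_of_forall_smul_eq (U : ι → A) {χ : ι → K} {x : V}
    (hx : ∀ i, U i • x = χ i • x) (f : MvPolynomial ι K) :
    aeval U f • x = eval χ f • x := by
  induction f using MvPolynomial.induction_on with
  | C a => rw [aeval_C, algebraMap_smul, eval_C]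
  | add p q hp hq => rw [map_add, map_add, add_smul, add_smul, hp, hq]
  | mul_X p i hp =>
    rw [map_mul, aeval_X, map_mul, eval_X, mul_smul, hx i, smul_comm, hp, smul_smul, mul_comm]

/-- **Theorem 5.2 (as printed).** Let a commutative `K`-algebra `A` with generators `U : ι → A` act
on `V`, and let `Λ` be a finite set of characters (values on the generators) containing `l`. Then
there is a polynomial `f` of total degree at most `Λ.card − 1` such that `f(U)` is the identity on
every common eigenvector with character `l` and kills every common eigenvector with character
`μ ∈ Λ`, `μ ≠ l`. (With `Λ` = the characters occurring in a completely reducible `V` of diversity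
`≤ p`, this is `deg f_λ ≤ p − 1` and `f_λ(U) = Π_λ`; see `thm_5_2_proj`.)
[cite: BergEtAl2024, Thm. 5.2, p.25 (PDF p.26)] locator: paper:arxiv-2411.03444 p0026.txt:L13–L32 -/
theorem thm_5_2 (U : ι → A) (Λ : Finset (ι → K)) {l : ι → K} (hl : l ∈ Λ) :
    ∃ f : MvPolynomial ι K, f.totalDegree ≤ Λ.card - 1 ∧
      (∀ x : V, (∀ i, U i • x = l i • x) → aeval U f • x = x) ∧
      ∀ μ ∈ Λ, μ ≠ l → ∀ x : V, (∀ i, U i • x = μ i • x) → aeval U f • x = 0 := by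
  obtain ⟨f, hdeg, h1, h0⟩ := exists_mvPolynomial_eval_eq_one_eq_zero Λ hl
  refine ⟨f, hdeg, fun x hx => ?_, fun μ hμ hne x hx => ?_⟩
  · rw [aeval_smul_of_forall_smul_eq U hx, h1, one_smul]
  · rw [aeval_smul_of_forall_smul_eq U hx, h0 μ hμ hne, zero_smul]

/-- **Theorem 5.2, the projection.** If moreover `V` is completely reducible with characters in
`Λ` — spanned by common eigenvectors of the generators whose characters lie in `Λ` — then `f(U)`
is the unique `A`-equivariant projection `Π_l` onto the `l`-isotypic component along the other
isotypic components: it is the identity on the common `l`-eigenvectors, takes values in them, is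
idempotent, its kernel is the span of the common eigenvectors with characters `μ ∈ Λ ∖ {l}`, and
it commutes with `A`.
[cite: BergEtAl2024, Thm. 5.2, eq. (16), p.25 (PDF p.26)] locator: paper:arxiv-2411.03444 p0026.txt:L13–L32 -/
theorem thm_5_2_proj (U : ι → A) (Λ : Finset (ι → K))
    (hV : ∀ x : V, x ∈ Submodule.span K {v : V | ∃ μ ∈ Λ, ∀ i, U i • v = μ i • v})
    {l : ι → K} (hl : l ∈ Λ) :
    ∃ f : MvPolynomial ι K, f.totalDegree ≤ Λ.card - 1 ∧
      (∀ x : V, (∀ i, U i • x = l i • x) → aeval U f • x = x) ∧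
      (∀ (x : V) (i : ι), U i • (aeval U f • x) = l i • (aeval U f • x)) ∧
      (∀ x : V, aeval U f • (aeval U f • x) = aeval U f • x) ∧
      (∀ x : V, aeval U f • x = 0 ↔
        x ∈ Submodule.span K {v : V | ∃ μ ∈ Λ, μ ≠ l ∧ ∀ i, U i • v = μ i • v}) ∧
      ∀ (a : A) (x : V), aeval U f • (a • x) = a • (aeval U f • x) := by
  obtain ⟨f, hdeg, h1, h0⟩ := exists_mvPolynomial_eval_eq_one_eq_zero Λ hl
  -- the value of `f` at a character of `Λ` is `1` (at `l`) or `0` (elsewhere)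
  have hval : ∀ μ ∈ Λ, (μ = l ∧ eval μ f = 1) ∨ (μ ≠ l ∧ eval μ f = 0) := by
    intro μ hμ
    by_cases h : μ = l
    · exact Or.inl ⟨h, h ▸ h1⟩
    · exact Or.inr ⟨h, h0 μ hμ h⟩
  set P := aeval U f with hP
  have hid : ∀ x : V, (∀ i, U i • x = l i • x) → P • x = x := fun x hx => by
    rw [aeval_smul_of_forall_smul_eq U hx, h1, one_smul]
  -- range inside the `l`-eigenvectors
  have hrange : ∀ (x : V) (i : ι), U i • (P • x) = l i • (P • x) := by
    intro x
    refine Submodule.span_induction (p := fun x _ => ∀ i, U i • (P • x) = l i • (P • x))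
      ?_ ?_ ?_ ?_ (hV x)
    · rintro v ⟨μ, hμ, hv⟩ i
      rw [aeval_smul_of_forall_smul_eq U hv]
      rcases hval μ hμ with ⟨rfl, h⟩ | ⟨_, h⟩
      · rw [h, one_smul, hv i]
      · rw [h, zero_smul, smul_zero, smul_zero]
    · intro i
      rw [smul_zero, smul_zero, smul_zero]
    · intro x y _ _ hx hy i
      rw [smul_add, smul_add, smul_add, hx i, hy i]
    · intro c x _ hx i
      rw [smul_comm P c x, smul_comm (U i) c, hx i, smul_comm (l i) c]
  -- the complement: `x - P • x` lies in the span of the other eigenvectors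
  have hcompl : ∀ x : V, x - P • x ∈
      Submodule.span K {v : V | ∃ μ ∈ Λ, μ ≠ l ∧ ∀ i, U i • v = μ i • v} := by
    intro x
    refine Submodule.span_induction (p := fun x _ => x - P • x ∈
      Submodule.span K {v : V | ∃ μ ∈ Λ, μ ≠ l ∧ ∀ i, U i • v = μ i • v}) ?_ ?_ ?_ ?_ (hV x)
    · rintro v ⟨μ, hμ, hv⟩
      rw [aeval_smul_of_forall_smul_eq U hv]
      rcases hval μ hμ with ⟨_, h⟩ | ⟨hne, h⟩
      · rw [h, one_smul, sub_self]
        exact Submodule.zero_mem _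
      · rw [h, zero_smul, sub_zero]
        exact Submodule.subset_span ⟨μ, hμ, hne, hv⟩
    · rw [smul_zero, sub_zero]
      exact Submodule.zero_mem _
    · intro x y _ _ hx hy
      rw [smul_add, add_sub_add_comm]
      exact Submodule.add_mem _ hx hy
    · intro c x _ hx
      rw [smul_comm P c x, ← smul_sub]
      exact Submodule.smul_mem _ c hx
  -- `P` kills the other eigenvectors, hence their span
  have hker : ∀ x ∈ Submodule.span K {v : V | ∃ μ ∈ Λ, μ ≠ l ∧ ∀ i, U i • v = μ i • v},
      P • x = 0 := by
    intro x hx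
    refine Submodule.span_induction (p := fun x _ => P • x = 0) ?_ ?_ ?_ ?_ hx
    · rintro v ⟨μ, hμ, hne, hv⟩
      rw [aeval_smul_of_forall_smul_eq U hv, h0 μ hμ hne, zero_smul]
    · exact smul_zero _
    · intro x y _ _ hx hy
      rw [smul_add, hx, hy, add_zero]
    · intro c x _ hx
      rw [smul_comm P c x, hx, smul_zero]
  refine ⟨f, hdeg, hid, hrange, fun x => hid _ (hrange x), fun x => ⟨fun hx => ?_, hker x⟩,
    fun a x => ?_⟩
  · have h := hcompl x
    rwa [hx, sub_zero] at h
  · rw [smul_smul, smul_smul, mul_comm]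

/-- **Theorem 5.2, the case `λ ∉ Λ`** (the printed proof sets `f_λ := 0` there): if `V` is spanned
by common eigenvectors of the generators with characters in `Λ` and `l ∉ Λ`, then the `l`-isotypic
component is zero — every common eigenvector with character `l` vanishes — so `Π_l = 0 = f(U)`
with `f = 0`. (Separate the finitely many characters `Λ ∪ {l}` by the interpolation polynomial.)
[cite: BergEtAl2024, Thm. 5.2 (proof), p.25 (PDF p.26)] locator: paper:arxiv-2411.03444 p0026.txt:L19–L21 -/
theorem thm_5_2_eq_zero_of_not_mem (U : ι → A) (Λ : Finset (ι → K))
    (hV : ∀ x : V, x ∈ Submodule.span K {v : V | ∃ μ ∈ Λ, ∀ i, U i • v = μ i • v})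
    {l : ι → K} (hl : l ∉ Λ) {x : V} (hx : ∀ i, U i • x = l i • x) : x = 0 := by
  classical
  obtain ⟨g, -, h1, h0⟩ :=
    exists_mvPolynomial_eval_eq_one_eq_zero (insert l Λ) (Finset.mem_insert_self l Λ)
  have hker : ∀ y ∈ Submodule.span K {v : V | ∃ μ ∈ Λ, ∀ i, U i • v = μ i • v},
      aeval U g • y = 0 := by
    intro y hy
    refine Submodule.span_induction (p := fun y _ => aeval U g • y = 0) ?_ ?_ ?_ ?_ hy
    · rintro v ⟨μ, hμ, hv⟩
      have hne : μ ≠ l := fun h => hl (h ▸ hμ)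
      rw [aeval_smul_of_forall_smul_eq U hv, h0 μ (Finset.mem_insert_of_mem hμ) hne, zero_smul]
    · exact smul_zero _
    · intro y z _ _ hy hz
      rw [smul_add, hy, hz, add_zero]
    · intro c y _ hy
      rw [smul_comm (aeval U g) c y, hy, smul_zero]
  have h := hker x (hV x)
  rwa [aeval_smul_of_forall_smul_eq U hx, h1, one_smul] at h

end Algebra

/-! ### Endomorphisms: the product of linear factors (17) -/

section End

variable {K V ι : Type*} [Field K] [AddCommGroup V] [Module K V]

/-- Dictionary: `x` is a common eigenvector of the family `T` with eigenvalues `χ` iff it lies in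
the tree's common eigenspace `⨅ i, eigenspace (T i) (χ i)` ("an irreducible representation is
spanned by a common eigenvector of the generators `U₁, …, U_q` with the corresponding eigenvalues").
[cite: BergEtAl2024, §5.1, p.24 (PDF p.25)] locator: paper:arxiv-2411.03444 p0025.txt:L41–L46 -/
theorem mem_iInf_eigenspace_iff (T : ι → Module.End K V) (χ : ι → K) (x : V) :
    x ∈ ⨅ i, Module.End.eigenspace (T i) (χ i) ↔ ∀ i, T i x = χ i • x := by
  simp only [Submodule.mem_iInf, Module.End.mem_eigenspace_iff]

/-- An ordered product of factors `c • (T i − a)` acts on a common eigenvector with eigenvalues `χ`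
as the scalar `∏ c (χ i − a)`. [folklore] -/
private theorem list_prod_apply_of_forall_eq (T : ι → Module.End K V) {χ : ι → K} {x : V}
    (hx : ∀ i, T i x = χ i • x) (L : List (ι × K × K)) :
    (L.map fun t => t.2.1 • (T t.1 - algebraMap K (Module.End K V) t.2.2)).prod x =
      (L.map fun t => t.2.1 * (χ t.1 - t.2.2)).prod • x := by
  induction L with
  | nil => simp
  | cons t L ih =>
    rw [List.map_cons, List.prod_cons, List.map_cons, List.prod_cons, Module.End.mul_apply, ih,
      LinearMap.smul_apply, LinearMap.sub_apply, LinearMap.map_smul, hx t.1,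
      Module.algebraMap_end_apply, smul_smul, smul_smul, ← sub_smul, smul_smul]
    congr 1
    ring

/-- **Theorem 5.2 in the form (17), for endomorphisms.** For a family of endomorphisms
`T : ι → End_K(V)` and a finite set `Λ` of joint eigenvalue patterns containing `l`, there is an
ordered product of at most `Λ.card − 1` factors `c • (T i − a · 1)` — each affine-linear in a single
generator, one per pattern `μ ∈ Λ ∖ {l}`, in a coordinate where `μ` and `l` differ — which is the
identity on the common eigenvectors with eigenvalues `l` and zero on those with eigenvalues
`μ ∈ Λ ∖ {l}`. No commutativity of the `T i` is needed for these identities (on a common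
eigenvector every factor acts by a scalar); for commuting, simultaneously diagonalizable `T i`
this product is the projector `Π_l` of Theorem 5.2, of length `≤ ℓ (p − 1)` when the generators have
length `≤ ℓ`. [cite: BergEtAl2024, Thm. 5.2, eq. (17), p.25 (PDF p.26)] locator: paper:arxiv-2411.03444 p0026.txt:L22–L40 -/
theorem thm_5_2_linearFactors (T : ι → Module.End K V) (Λ : Finset (ι → K)) {l : ι → K}
    (hl : l ∈ Λ) :
    ∃ L : List (ι × K × K), L.length ≤ Λ.card - 1 ∧
      (∀ x : V, (∀ i, T i x = l i • x) →
        (L.map fun t => t.2.1 • (T t.1 - algebraMap K (Module.End K V) t.2.2)).prod x = x) ∧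
      ∀ μ ∈ Λ, μ ≠ l → ∀ x : V, (∀ i, T i x = μ i • x) →
        (L.map fun t => t.2.1 • (T t.1 - algebraMap K (Module.End K V) t.2.2)).prod x = 0 := by
  classical
  by_cases hempty : Λ.erase l = ∅
  · -- only `l` occurs: the empty product
    refine ⟨[], by simp, fun x _ => by simp, fun μ hμ hne => ?_⟩
    exact absurd (Finset.mem_erase.2 ⟨hne, hμ⟩) (by simp [hempty])
  · -- a coordinate `i μ` where `μ ≠ l` differs from `l`
    obtain ⟨μ₀, hμ₀⟩ := Finset.nonempty_iff_ne_empty.2 hempty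
    obtain ⟨i₀, -⟩ := Function.ne_iff.1 (Finset.mem_erase.1 hμ₀).1
    let i : (ι → K) → ι := fun μ => if h : μ ≠ l then Classical.choose (Function.ne_iff.1 h) else i₀
    have hi : ∀ μ, μ ≠ l → μ (i μ) ≠ l (i μ) := by
      intro μ h
      simp only [i, dif_pos h]
      exact Classical.choose_spec (Function.ne_iff.1 h)
    -- one factor per `μ ∈ Λ \ {l}`
    let factor : (ι → K) → ι × K × K := fun μ => (i μ, (l (i μ) - μ (i μ))⁻¹, μ (i μ))
    refine ⟨(Λ.erase l).toList.map factor, ?_, fun x hx => ?_, fun μ hμ hne x hx => ?_⟩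
    · rw [List.length_map, Finset.length_toList, Finset.card_erase_of_mem hl]
    · rw [list_prod_apply_of_forall_eq T hx, List.map_map]
      convert one_smul K x
      refine List.prod_eq_one fun c hc => ?_
      obtain ⟨μ, hμ, rfl⟩ := List.mem_map.1 hc
      have hne : μ ≠ l := (Finset.mem_erase.1 (Finset.mem_toList.1 hμ)).1
      simp only [Function.comp_apply, factor]
      exact inv_mul_cancel₀ (sub_ne_zero.2 (Ne.symm (hi μ hne)))
    · rw [list_prod_apply_of_forall_eq T hx, List.map_map]
      convert zero_smul K x
      refine List.prod_eq_zero ?_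
      refine List.mem_map.2 ⟨μ, Finset.mem_toList.2 (Finset.mem_erase.2 ⟨hne, hμ⟩), ?_⟩
      simp only [Function.comp_apply, factor, sub_self, mul_zero]

end End

end BergEtAl2024

end Literature.Barriers.ValiantsHypothesis
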